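import Mathlib.Topology.LocallyConstant.Basic
import Mathlib.MeasureTheory.Integral.Bochner.Set
import HarnessLib

/-!
# A locally constant function of a continuously moving COMPACT family is locally constant in the parameter (tube lemma), with the
# parametric-integral and finite-window-sum forms

Topic `Topology`; namespace `Literature.Topology`.  THEOREMS ONLY (Mathlib-only; no definition, no instance, no notation, no named fact, no `sorry`).
Cell `pub/hodgecm-mathlib` (D-0151), crux H413 = `stmt-HodgeConjecture-24833`, road «W′» = «R1LL-WILD», architect A-p16 (g28) RULING A-37 deal (Ψ3)
«THE WINDOW SUM IS EVENTUALLY CONSTANT» → B-p04 (g35); census `CENSUS-Psi3-WindowSumLocallyConstant.B-p04g35.md` b01cfe216e5d1427.  This is FILE 1, the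
GENERIC ENGINE; FILE 2 instantiates it on the elliptic torus of `U(Φ₂)(L⁺_v)`.

THE POINT.  In Labesse's computation of the `κ`-orbital integral at a ramified (tame or wild) place [Labesse2024 Prop. 0.0.11, Th. 0.0.12; LabesseLanglands1979 §2],
after re-indexing the shells the WINDOW SUM is
`W(t) = Σ_{i ∈ I} q^i κ(ϖ)^{−i} ∫_{𝒪^×} κ(η) · f̄(A_i(t, η)) dη`
where `f̄` (a `K`-average of a test function) is LOCALLY CONSTANT, `η` ranges over the COMPACT `𝒪^×`, `I` is a finite window, and the matrix `A_i(t, η)` depends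
JOINTLY CONTINUOUSLY on `(t, η)`.  Such a `W` is LOCALLY CONSTANT in `t` — at singular `t` too — by the tube lemma; no threshold has to be computed by hand.  The file
isolates exactly this mechanism:

* `eventually_forall_apply_eq_of_isLocallyConstant` — `g` locally constant, `S` compact, `(x, k) ↦ A x k` continuous at every `(x₀, k)`, `k ∈ S`
  ⟹ `∀ᶠ x in 𝓝 x₀, ∀ k ∈ S, g (A x k) = g (A x₀ k)` (the values FREEZE on the whole compact set simultaneously); `Continuous (uncurry A)` corollary;
* `isLocallyConstant_integral_indicator_of_forall_eventually` ∕ `isLocallyConstant_integral_of_forall_eventually` — a parametric integral whose integrand freezes on `S`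
  (resp. everywhere) near every parameter is locally constant (ANY measure, no integrability needed);
* `isLocallyConstant_integral_indicator_mul_apply` — the weighted form `x ↦ ∫ k, S.indicator c k * g (A x k) ∂μ` (any weight `c`, e.g. a quadratic character `κ`);
* `isLocallyConstant_finset_sum_fun` and the WINDOW form `isLocallyConstant_sum_mul_integral_indicator_mul_apply`
  `x ↦ ∑ i ∈ I, a i * ∫ k, S.indicator c k * g (A i x k) ∂μ`;
* `eventually_mem_imp_eq_of_isLocallyConstant` — the shape in which the (R1-core) fold ★ `rankOneUnstable_core_of_signedWindow` consumes its `hΨ`∕`hE` binders: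
  `∀ s, ∀ᶠ t in 𝓝 s, t ∈ U → Ψ t = Ψ s`.

HONEST LABEL: HC_CM is proved only modulo the 2 remaining named inputs (hLiu418, h413) until rung 0 closes; this file is unconditional point-set topology.

## References
* [Labesse2024StabilisationGermesSL2] J.-P. Labesse, *Stabilisation des germes de SL(2)*, arXiv:2411.14820: Prop. 0.0.10, 0.0.11, Th. 0.0.12 (pp. 7–8).
* [LabesseLanglands1979] J.-P. Labesse, R. P. Langlands, *L-indistinguishability for SL(2)*, Canad. J. Math. 31 (1979): §2.
* [Bourbaki1995] N. Bourbaki, *General Topology: Chapters 1–4*, Springer (1995): Ch. I §10.2 (tube lemma).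
-/

set_option autoImplicit false

open Set Filter Topology MeasureTheory

namespace Literature.Topology

section Tube

variable {X K Y α : Type*} [TopologicalSpace X] [TopologicalSpace K] [TopologicalSpace Y]

/-- **THE VALUES FREEZE ON A COMPACT SET (tube lemma for locally constant functions).**  If `g` is locally constant, `S` is compact and the family
`(x, k) ↦ A x k` is continuous at every point `(x₀, k)` with `k ∈ S`, then for `x` near `x₀` one has `g (A x k) = g (A x₀ k)` for ALL `k ∈ S` simultaneously.
[cite: Bourbaki1995, Ch. I §10.2 Th. 1 (tube lemma)] [cite: LabesseLanglands1979, §2] -/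
theorem eventually_forall_apply_eq_of_isLocallyConstant {g : Y → α} (hg : IsLocallyConstant g) {S : Set K} (hS : IsCompact S)
    {A : X → K → Y} {x₀ : X} (hA : ∀ k ∈ S, ContinuousAt (Function.uncurry A) (x₀, k)) :
    ∀ᶠ x in 𝓝 x₀, ∀ k ∈ S, g (A x k) = g (A x₀ k) := by
  refine hS.eventually_forall_of_forall_eventually (P := fun x k => g (A x k) = g (A x₀ k)) fun k hk => ?_
  -- the fibre of `g` through `g (A x₀ k)` is an open neighbourhood of `A x₀ k`
  have hfib : {y : Y | g y = g (A x₀ k)} ∈ 𝓝 (A x₀ k) := (hg.isOpen_fiber (g (A x₀ k))).mem_nhds rfl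
  have h1 : ∀ᶠ z : X × K in 𝓝 (x₀, k), g (A z.1 z.2) = g (A x₀ k) := (hA k hk).preimage_mem_nhds hfib
  -- the same along the slice `x = x₀`
  have hslice : ContinuousAt (fun k' : K => ((x₀, k') : X × K)) k := by fun_prop
  have h2 : ∀ᶠ k' in 𝓝 k, g (A x₀ k') = g (A x₀ k) := hslice.preimage_mem_nhds h1
  have h2' : ∀ᶠ z : X × K in 𝓝 (x₀, k), g (A x₀ z.2) = g (A x₀ k) :=
    (continuous_snd.continuousAt (x := ((x₀, k) : X × K))).preimage_mem_nhds h2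
  filter_upwards [h1, h2'] with z hz1 hz2
  rw [hz1, hz2]

/-- Tube lemma, jointly continuous family. [cite: Bourbaki1995, Ch. I §10.2 Th. 1 (tube lemma)] -/
theorem eventually_forall_apply_eq_of_isLocallyConstant_of_continuous {g : Y → α} (hg : IsLocallyConstant g) {S : Set K} (hS : IsCompact S)
    {A : X → K → Y} (hA : Continuous (Function.uncurry A)) (x₀ : X) :
    ∀ᶠ x in 𝓝 x₀, ∀ k ∈ S, g (A x k) = g (A x₀ k) :=
  eventually_forall_apply_eq_of_isLocallyConstant hg hS fun _ _ => hA.continuousAt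

/-- Tube lemma on a compact space: the values freeze everywhere. [cite: Bourbaki1995, Ch. I §10.2 Th. 1 (tube lemma)] -/
theorem eventually_forall_apply_eq_of_isLocallyConstant_of_compactSpace [CompactSpace K] {g : Y → α} (hg : IsLocallyConstant g)
    {A : X → K → Y} {x₀ : X} (hA : ∀ k, ContinuousAt (Function.uncurry A) (x₀, k)) :
    ∀ᶠ x in 𝓝 x₀, ∀ k, g (A x k) = g (A x₀ k) :=
  (eventually_forall_apply_eq_of_isLocallyConstant hg isCompact_univ fun k _ => hA k).mono fun _ h k => h k (mem_univ k)

/-- Tube lemma, family continuous on a neighbourhood `U ×ˢ S` only (coefficient maps defined near `x₀`). [cite: Bourbaki1995, Ch. I §10.2 Th. 1 (tube lemma)] -/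
theorem eventually_forall_apply_eq_of_isLocallyConstant_of_continuousOn {g : Y → α} (hg : IsLocallyConstant g) {S : Set K} (hS : IsCompact S)
    {A : X → K → Y} {x₀ : X} {U : Set X} (hU : U ∈ 𝓝 x₀) {V : Set K} (hV : V ∈ 𝓝ˢ S)
    (hA : ContinuousOn (Function.uncurry A) (U ×ˢ V)) :
    ∀ᶠ x in 𝓝 x₀, ∀ k ∈ S, g (A x k) = g (A x₀ k) := by
  refine eventually_forall_apply_eq_of_isLocallyConstant hg hS fun k hk => ?_
  exact hA.continuousAt (prod_mem_nhds hU (mem_nhdsSet_iff_forall.1 hV k hk))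

omit [TopologicalSpace K] in
/-- A function all of whose values freeze near every point is locally constant (restatement of `IsLocallyConstant.iff_eventually_eq` for families:
if `G x k = G x₀ k` for all `k ∈ S` near every `x₀`, then every functional of `k ↦ G x k` on `S` is locally constant — here the restriction itself).
[cite: Bourbaki1995, Ch. I §10.2 Th. 1 (tube lemma)] -/
theorem isLocallyConstant_restrict_of_forall_eventually {β : Type*} {G : X → K → β} {S : Set K}
    (hG : ∀ x₀, ∀ᶠ x in 𝓝 x₀, ∀ k ∈ S, G x k = G x₀ k) :
    IsLocallyConstant fun x => S.restrict (G x) := by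
  refine (IsLocallyConstant.iff_eventually_eq _).2 fun x₀ => (hG x₀).mono fun x hx => ?_
  funext k
  exact hx k k.2

end Tube

section Integral

variable {X K : Type*} [TopologicalSpace X] [MeasurableSpace K]
variable {E : Type*} [NormedAddCommGroup E] [NormedSpace ℝ E]

/-- **A PARAMETRIC INTEGRAL WHOSE INTEGRAND FREEZES ON `S` NEAR EVERY PARAMETER IS LOCALLY CONSTANT** (indicator form: the integrand is cut to `S`; ANY measure,
no integrability needed — equal integrands have equal integrals). [cite: LabesseLanglands1979, §2] [cite: Bourbaki1995, Ch. I §10.2 Th. 1 (tube lemma)] -/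
theorem isLocallyConstant_integral_indicator_of_forall_eventually (μ : Measure K) {G : X → K → E} {S : Set K}
    (hG : ∀ x₀, ∀ᶠ x in 𝓝 x₀, ∀ k ∈ S, G x k = G x₀ k) :
    IsLocallyConstant fun x => ∫ k, S.indicator (G x) k ∂μ := by
  refine (IsLocallyConstant.iff_eventually_eq _).2 fun x₀ => (hG x₀).mono fun x hx => ?_
  refine integral_congr_ae (Eventually.of_forall fun k => ?_)
  by_cases hk : k ∈ S
  · simp only [indicator_of_mem hk, hx k hk]
  · simp only [indicator_of_notMem hk]

/-- The same with the integrand freezing EVERYWHERE (e.g. on a compact space). [cite: LabesseLanglands1979, §2] -/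
theorem isLocallyConstant_integral_of_forall_eventually (μ : Measure K) {G : X → K → E}
    (hG : ∀ x₀, ∀ᶠ x in 𝓝 x₀, ∀ k, G x k = G x₀ k) :
    IsLocallyConstant fun x => ∫ k, G x k ∂μ := by
  refine (IsLocallyConstant.iff_eventually_eq _).2 fun x₀ => (hG x₀).mono fun x hx => ?_
  exact integral_congr_ae (Eventually.of_forall fun k => hx k)

/-- Set-integral form (`S` measurable). [cite: LabesseLanglands1979, §2] -/
theorem isLocallyConstant_setIntegral_of_forall_eventually (μ : Measure K) {G : X → K → E} {S : Set K} (hSm : MeasurableSet S)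
    (hG : ∀ x₀, ∀ᶠ x in 𝓝 x₀, ∀ k ∈ S, G x k = G x₀ k) :
    IsLocallyConstant fun x => ∫ k in S, G x k ∂μ := by
  refine (IsLocallyConstant.iff_eventually_eq _).2 fun x₀ => (hG x₀).mono fun x hx => ?_
  exact setIntegral_congr_fun hSm fun k hk => hx k hk

variable [TopologicalSpace K] {Y : Type*} [TopologicalSpace Y] {R : Type*} [NormedRing R] [NormedSpace ℝ R]

/-- **THE WEIGHTED PARAMETRIC INTEGRAL OF A LOCALLY CONSTANT FUNCTION OVER A CONTINUOUSLY MOVING COMPACT FAMILY IS LOCALLY CONSTANT**: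
`x ↦ ∫ k, 1_S(k)·c(k)·g(A x k) dμ(k)` for `g` locally constant, `S` compact, `(x,k) ↦ A x k` continuous at `{x} × S` for every `x`, ANY weight `c` (e.g. a character
`κ`) and ANY measure `μ`.  This is the `t`-local constancy of one shell term `∫_{𝒪^×} κ(η) f̄(A(t,η)) dη` of Labesse's window sum.
[cite: Labesse2024StabilisationGermesSL2, Prop. 0.0.11, Th. 0.0.12 pp. 7–8] [cite: LabesseLanglands1979, §2] -/
theorem isLocallyConstant_integral_indicator_mul_apply (μ : Measure K) {g : Y → R} (hg : IsLocallyConstant g) {S : Set K} (hS : IsCompact S)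
    (c : K → R) {A : X → K → Y} (hA : ∀ x, ∀ k ∈ S, ContinuousAt (Function.uncurry A) (x, k)) :
    IsLocallyConstant fun x => ∫ k, S.indicator c k * g (A x k) ∂μ := by
  refine (IsLocallyConstant.iff_eventually_eq _).2 fun x₀ =>
    (eventually_forall_apply_eq_of_isLocallyConstant hg hS (hA x₀)).mono fun x hx => ?_
  refine integral_congr_ae (Eventually.of_forall fun k => ?_)
  by_cases hk : k ∈ S
  · simp only [hx k hk]
  · simp only [indicator_of_notMem hk, zero_mul]

/-- Jointly continuous family: `x ↦ ∫ k, 1_S(k)·c(k)·g(A x k) dμ` is locally constant. [cite: LabesseLanglands1979, §2] -/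
theorem isLocallyConstant_integral_indicator_mul_apply_of_continuous (μ : Measure K) {g : Y → R} (hg : IsLocallyConstant g) {S : Set K}
    (hS : IsCompact S) (c : K → R) {A : X → K → Y} (hA : Continuous (Function.uncurry A)) :
    IsLocallyConstant fun x => ∫ k, S.indicator c k * g (A x k) ∂μ :=
  isLocallyConstant_integral_indicator_mul_apply μ hg hS c fun _ _ _ => hA.continuousAt

/-- Compact parameter-free domain: `x ↦ ∫ k, c(k)·g(A x k) dμ` over a COMPACT SPACE `K` is locally constant. [cite: LabesseLanglands1979, §2] -/
theorem isLocallyConstant_integral_mul_apply_of_compactSpace [CompactSpace K] (μ : Measure K) {g : Y → R} (hg : IsLocallyConstant g)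
    (c : K → R) {A : X → K → Y} (hA : ∀ x k, ContinuousAt (Function.uncurry A) (x, k)) :
    IsLocallyConstant fun x => ∫ k, c k * g (A x k) ∂μ := by
  refine (IsLocallyConstant.iff_eventually_eq _).2 fun x₀ =>
    (eventually_forall_apply_eq_of_isLocallyConstant_of_compactSpace hg (hA x₀)).mono fun x hx => ?_
  exact integral_congr_ae (Eventually.of_forall fun k => by simp only [hx k])

end Integral

section Window

variable {X : Type*} [TopologicalSpace X]

/-- **Finite sums of locally constant functions are locally constant.** [cite: Bourbaki1995, Ch. I §10.2 Th. 1 (tube lemma)] -/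
theorem isLocallyConstant_finset_sum_fun {ι M : Type*} [AddCommMonoid M] (I : Finset ι) {F : ι → X → M}
    (hF : ∀ i ∈ I, IsLocallyConstant (F i)) :
    IsLocallyConstant fun x => ∑ i ∈ I, F i x := by
  classical
  induction I using Finset.induction_on with
  | empty =>
    simp only [Finset.sum_empty]
    exact IsLocallyConstant.const (0 : M)
  | insert a s ha ih =>
    have h := (hF a (Finset.mem_insert_self a s)).add (ih fun i hi => hF i (Finset.mem_insert_of_mem hi))
    simp only [Finset.sum_insert ha]
    exact h

/-- Finite products of locally constant functions are locally constant. [cite: Bourbaki1995, Ch. I §10.2 Th. 1 (tube lemma)] -/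
theorem isLocallyConstant_finset_prod_fun {ι M : Type*} [CommMonoid M] (I : Finset ι) {F : ι → X → M}
    (hF : ∀ i ∈ I, IsLocallyConstant (F i)) :
    IsLocallyConstant fun x => ∏ i ∈ I, F i x := by
  classical
  induction I using Finset.induction_on with
  | empty =>
    simp only [Finset.prod_empty]
    exact IsLocallyConstant.const (1 : M)
  | insert a s ha ih =>
    have h := (hF a (Finset.mem_insert_self a s)).mul (ih fun i hi => hF i (Finset.mem_insert_of_mem hi))
    simp only [Finset.prod_insert ha]
    exact h

variable {K Y : Type*} [MeasurableSpace K] [TopologicalSpace K] [TopologicalSpace Y] {R : Type*} [NormedRing R] [NormedSpace ℝ R]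

/-- **THE WINDOW SUM IS LOCALLY CONSTANT**: `x ↦ ∑_{i ∈ I} a_i · ∫ 1_S(k)·c_i(k)·g(A_i x k) dμ(k)` for a FINITE window `I`, `g` locally constant, `S` compact and each family
`(x,k) ↦ A_i x k` continuous at `{x} × S` — Labesse's `W(t) = Σ_i q^i κ(ϖ)^{−i} ∫_{𝒪^×} κ(η) f̄(A_i(t,η)) dη` is locally constant in `t`, singular `t` included.
[cite: Labesse2024StabilisationGermesSL2, Prop. 0.0.11, Th. 0.0.12 pp. 7–8] [cite: LabesseLanglands1979, §2] -/
theorem isLocallyConstant_sum_mul_integral_indicator_mul_apply {ι : Type*} (I : Finset ι) (a : ι → R) (μ : Measure K) {g : Y → R}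
    (hg : IsLocallyConstant g) {S : Set K} (hS : IsCompact S) (c : ι → K → R) {A : ι → X → K → Y}
    (hA : ∀ i ∈ I, ∀ x, ∀ k ∈ S, ContinuousAt (Function.uncurry (A i)) (x, k)) :
    IsLocallyConstant fun x => ∑ i ∈ I, a i * ∫ k, S.indicator (c i) k * g (A i x k) ∂μ :=
  isLocallyConstant_finset_sum_fun I fun i hi =>
    (IsLocallyConstant.const (a i)).mul (isLocallyConstant_integral_indicator_mul_apply μ hg hS (c i) (hA i hi))

/-- Window sum, jointly continuous families. [cite: Labesse2024StabilisationGermesSL2, Th. 0.0.12] -/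
theorem isLocallyConstant_sum_mul_integral_indicator_mul_apply_of_continuous {ι : Type*} (I : Finset ι) (a : ι → R) (μ : Measure K) {g : Y → R}
    (hg : IsLocallyConstant g) {S : Set K} (hS : IsCompact S) (c : ι → K → R) {A : ι → X → K → Y}
    (hA : ∀ i ∈ I, Continuous (Function.uncurry (A i))) :
    IsLocallyConstant fun x => ∑ i ∈ I, a i * ∫ k, S.indicator (c i) k * g (A i x k) ∂μ :=
  isLocallyConstant_sum_mul_integral_indicator_mul_apply I a μ hg hS c fun i hi _ _ _ => (hA i hi).continuousAt

end Window

section FoldShape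

variable {X β : Type*} [TopologicalSpace X]

/-- **The fold's binder shape.**  A locally constant `Ψ` satisfies, at EVERY point `s` (singular or not) and for ANY guard `U`:
`∀ᶠ t in 𝓝 s, t ∈ U → Ψ t = Ψ s` — the `hΨ`∕`hE` hypotheses of ★ `rankOneUnstable_core_of_signedWindow` by `exact`. [cite: LabesseLanglands1979, §2] -/
theorem eventually_mem_imp_eq_of_isLocallyConstant {Ψ : X → β} (hΨ : IsLocallyConstant Ψ) (U : Set X) (s : X) :
    ∀ᶠ t in 𝓝 s, t ∈ U → Ψ t = Ψ s :=
  (hΨ.eventually_eq s).mono fun _ h _ => h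

/-- Guarded form with a premise on `s` (e.g. `¬ IsRegularElt s`), as the fold literally spells it. [cite: LabesseLanglands1979, §2] -/
theorem forall_imp_eventually_mem_imp_eq_of_isLocallyConstant {Ψ : X → β} (hΨ : IsLocallyConstant Ψ) (P : X → Prop) (U : Set X) :
    ∀ s, P s → ∀ᶠ t in 𝓝 s, t ∈ U → Ψ t = Ψ s :=
  fun s _ => eventually_mem_imp_eq_of_isLocallyConstant hΨ U s

/-- A product of a locally constant factor and a factor that is eventually constant at `s` along `U` is eventually constant at `s` along `U` — the
(Ψ3) × (Ψ4) assembly of `Ψ = (symbol factor) · (window sum)`. [cite: LabesseLanglands1979, §2] -/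
theorem eventually_mem_imp_mul_eq {M : Type*} [Mul M] {Φ W : X → M} {U : Set X} {s : X}
    (hΦ : ∀ᶠ t in 𝓝 s, t ∈ U → Φ t = Φ s) (hW : ∀ᶠ t in 𝓝 s, t ∈ U → W t = W s) :
    ∀ᶠ t in 𝓝 s, t ∈ U → Φ t * W t = Φ s * W s := by
  filter_upwards [hΦ, hW] with t ht ht' hU
  rw [ht hU, ht' hU]

end FoldShape

end Literature.Topology
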